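import Mathlib.Combinatorics.SetFamily.FourFunctions
import Summits.CriticalPhenomena.PercolationContinuityZ3.Theorems.PercNearOneGluingNoHeavyLowerTailSahiCombFiveUpSet

/-!
# The five-up-set inequality on a general finite distributive lattice: Kleitman's lemma and the hybrid lemma for any
# order-reversing bijection, and the lattice form of the conjecture

Support file of the one-cut programme (crux `NoHeavyLowerTail`, stmt-CriticalPhenomena-4575; cell `prim-masterthm`, seat P5 gen 7;
report `P5-LORENTZIAN-TEST.md` §12.1).  The gen-6 conjecture `FiveUpSet.FiveUpSetIneq` lives on the Boolean lattice `Finset α` with the antipode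
`s ↦ sᶜ`.  Census (report §12.1, code `code7/spade_poset.py`, `spade_general.py`): the inequality holds, with 0 violations, on products of chains
with coordinate reversal (`[4]×[3]` exhaustive, 8.4e6 quintuples), on `J(Q)` for self-dual `Q`, and on `2^3` with twisted — even NON-involutive —
antipodes.  This file records the lattice-general setting and proves its two lemmas there:

* `LatticeFiveUpSet.card_mul_card_le` — Harris for two up-sets of a finite distributive lattice `L`: `#U · #X ≤ |L| · #(U ∩ X)`
  (from Mathlib's Daykin inequality `Finset.le_card_infs_mul_card_sups`, a corollary of the four functions theorem [Ahlswede–Daykin]);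
* `LatticeFiveUpSet.card_inter_mul_le` — up-set versus down-set: `|L| · #(U ∩ D) ≤ #U · #D`;
* **`LatticeFiveUpSet.card_inter_image_le`** — KLEITMAN'S LEMMA for ANY order-reversing bijection `τ` of `L`: `#(U ∩ τ X) ≤ #(U ∩ X)` for up-sets `U, X`;
* **`LatticeFiveUpSet.card_inter_hybrid_le`** — the hybrid lemma: `#(U ∩ ((B ∩ D) ∪ (τ B \ D))) ≤ #(U ∩ B)` for up-sets `U, B` and a down-set `D`;
* `LatticeFiveUpSet.FiveUpSetIneqLattice` (`@[conjecture]`, report §12.1 (♠_L)): the five-up-set inequality for every finite distributive lattice and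
  every order-reversing bijection; **`fiveUpSetIneq_of_lattice : FiveUpSetIneqLattice → FiveUpSet.FiveUpSetIneq`** (the cube with `compl` is an instance).
HONEST LABEL: two lattice-general lemmas (proved) and a typed generalisation of an OPEN conjecture; nothing here proves `FiveUpSetIneq`. [this work]
-/

namespace Summit.CriticalPhenomena.PercolationContinuityZ3.Theorems

namespace LatticeFiveUpSet

open Finset
open scoped FinsetFamily

variable {L : Type*} [DistribLattice L] [Fintype L] [DecidableEq L]

/-! ### Harris / Kleitman on a finite distributive lattice -/

/-- **Harris for up-sets** of a finite distributive lattice: `#U · #X ≤ |L| · #(U ∩ X)`.  From the Daykin inequality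
`#U · #X ≤ #(U ⊼ X) · #(U ⊻ X)` (Mathlib), `U ⊻ X ⊆ U ∩ X` for up-sets, and `#(U ⊼ X) ≤ |L|`. [this work] -/
theorem card_mul_card_le (U X : Finset L) (hU : IsUpperSet (U : Set L)) (hX : IsUpperSet (X : Set L)) :
    U.card * X.card ≤ Fintype.card L * (U ∩ X).card := by
  have hD := Finset.le_card_infs_mul_card_sups U X
  have h1 : (U ⊼ X).card ≤ Fintype.card L := Finset.card_le_univ _
  have h2 : U ⊻ X ⊆ U ∩ X := by
    rw [Finset.sups_subset_iff]
    intro a ha b hb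
    rw [mem_inter]
    exact ⟨hU (le_sup_left : a ≤ a ⊔ b) ha, hX (le_sup_right : b ≤ a ⊔ b) hb⟩
  calc U.card * X.card ≤ (U ⊼ X).card * (U ⊻ X).card := hD
    _ ≤ Fintype.card L * (U ∩ X).card := Nat.mul_le_mul h1 (card_le_card h2)

omit [Fintype L] [DecidableEq L] in
/-- The complement of a down-set is an up-set. [this work] -/
theorem isUpperSet_compl_of_isLowerSet [Fintype L] [DecidableEq L] {D : Finset L} (hD : IsLowerSet (D : Set L)) :
    IsUpperSet (((Finset.univ : Finset L) \ D : Finset L) : Set L) := by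
  intro a b hab ha
  rw [mem_coe, mem_sdiff] at ha ⊢
  exact ⟨mem_univ _, fun hb => ha.2 (hD hab hb)⟩

/-- **Up-set versus down-set**: `|L| · #(U ∩ D) ≤ #U · #D` for an up-set `U` and a down-set `D` (Harris applied to `U` and `univ \ D`). [this work] -/
theorem card_inter_mul_le (U D : Finset L) (hU : IsUpperSet (U : Set L)) (hD : IsLowerSet (D : Set L)) :
    Fintype.card L * (U ∩ D).card ≤ U.card * D.card := by
  have h := card_mul_card_le U (univ \ D) hU (isUpperSet_compl_of_isLowerSet hD)
  have e1 : (U ∩ (univ \ D)).card + (U ∩ D).card = U.card := by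
    have e : U = (U ∩ (univ \ D)) ∪ (U ∩ D) := by
      ext a; simp only [mem_union, mem_inter, mem_sdiff, mem_univ, true_and]; tauto
    have d : Disjoint (U ∩ (univ \ D)) (U ∩ D) := by
      rw [disjoint_left]; intro a ha ha'
      simp only [mem_inter, mem_sdiff] at ha ha'
      exact ha.2.2 ha'.2
    conv_rhs => rw [e]
    rw [card_union_of_disjoint d]
  have e2 : (univ \ D).card + D.card = Fintype.card L := by
    rw [card_sdiff_of_subset (subset_univ D), card_univ, Nat.sub_add_cancel (card_le_univ D)]
  -- with a = #U, d = #D, n = |L|, i = #(U ∩ D), j = #(U ∩ (univ \ D)), c = #(univ \ D):  h : a c ≤ n j, e1 : j + i = a, e2 : c + d = n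
  have key : Fintype.card L * (U ∩ D).card + Fintype.card L * (U ∩ (univ \ D)).card ≤
      U.card * D.card + Fintype.card L * (U ∩ (univ \ D)).card := by
    calc Fintype.card L * (U ∩ D).card + Fintype.card L * (U ∩ (univ \ D)).card
        = Fintype.card L * ((U ∩ (univ \ D)).card + (U ∩ D).card) := by ring
      _ = Fintype.card L * U.card := by rw [e1]
      _ = ((univ \ D).card + D.card) * U.card := by rw [e2]
      _ = U.card * (univ \ D).card + U.card * D.card := by ring
      _ ≤ Fintype.card L * (U ∩ (univ \ D)).card + U.card * D.card := Nat.add_le_add_right h _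
      _ = U.card * D.card + Fintype.card L * (U ∩ (univ \ D)).card := by ring
  exact Nat.le_of_add_le_add_right key

omit [Fintype L] in
/-- The image of an up-set under an order-reversing bijection is a down-set. [this work] -/
theorem isLowerSet_image (τ : L ≃ L) (hτ : ∀ a b : L, τ a ≤ τ b ↔ b ≤ a) {X : Finset L}
    (hX : IsUpperSet (X : Set L)) : IsLowerSet ((X.image τ : Finset L) : Set L) := by
  intro a b hba ha
  rw [mem_coe, mem_image] at ha ⊢
  obtain ⟨x, hx, rfl⟩ := ha
  refine ⟨τ.symm b, ?_, by simp⟩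
  have : x ≤ τ.symm b := by
    rw [← hτ]; simpa using hba
  exact hX this hx

/-- **Kleitman's antipodal lemma on a finite distributive lattice**, for ANY order-reversing bijection `τ`: for up-sets `U, X`,
`#(U ∩ τ X) ≤ #(U ∩ X)`.  Proof: `|L| · #(U ∩ τX) ≤ #U · #(τX) = #U · #X ≤ |L| · #(U ∩ X)`. [this work] -/
theorem card_inter_image_le (τ : L ≃ L) (hτ : ∀ a b : L, τ a ≤ τ b ↔ b ≤ a) (U X : Finset L)
    (hU : IsUpperSet (U : Set L)) (hX : IsUpperSet (X : Set L)) :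
    (U ∩ X.image τ).card ≤ (U ∩ X).card := by
  have h1 := card_inter_mul_le U (X.image τ) hU (isLowerSet_image τ hτ hX)
  rw [card_image_of_injective X τ.injective] at h1
  have h2 := card_mul_card_le U X hU hX
  by_cases hpos : 0 < Fintype.card L
  · exact Nat.le_of_mul_le_mul_left (h1.trans h2) hpos
  · haveI : IsEmpty L := Fintype.card_eq_zero_iff.1 (Nat.eq_zero_of_not_pos hpos)
    simp [Finset.eq_empty_of_isEmpty U]

/-! ### The hybrid lemma -/

omit [Fintype L] in
/-- `U \ D` is an up-set for `U` up and `D` down. [this work] -/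
theorem isUpperSet_sdiff {U D : Finset L} (hU : IsUpperSet (U : Set L)) (hD : IsLowerSet (D : Set L)) :
    IsUpperSet ((U \ D : Finset L) : Set L) := by
  intro a b hab ha
  rw [mem_coe, mem_sdiff] at ha ⊢
  exact ⟨hU hab ha.1, fun hb => ha.2 (hD hab hb)⟩

/-- **Hybrid lemma** on a finite distributive lattice: for up-sets `U, B`, a down-set `D` and an order-reversing bijection `τ`,
`#(U ∩ ((B ∩ D) ∪ (τB \ D))) ≤ #(U ∩ B)` — the hybrid of `B` and `τB` glued along the cut `D` injects upward into `B` (Hall form).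
Proof: Kleitman's lemma on the up-set `U \ D`. [this work] -/
theorem card_inter_hybrid_le (τ : L ≃ L) (hτ : ∀ a b : L, τ a ≤ τ b ↔ b ≤ a) (U B D : Finset L)
    (hU : IsUpperSet (U : Set L)) (hB : IsUpperSet (B : Set L)) (hD : IsLowerSet (D : Set L)) :
    (U ∩ ((B ∩ D) ∪ (B.image τ \ D))).card ≤ (U ∩ B).card := by
  have hK := card_inter_image_le τ hτ (U \ D) B (isUpperSet_sdiff hU hD) hB
  have e1 : U ∩ ((B ∩ D) ∪ (B.image τ \ D)) = (U ∩ D ∩ B) ∪ ((U \ D) ∩ B.image τ) := by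
    ext a; simp only [mem_inter, mem_union, mem_sdiff]; tauto
  have d1 : Disjoint (U ∩ D ∩ B) ((U \ D) ∩ B.image τ) := by
    rw [disjoint_left]; intro a ha ha'
    simp only [mem_inter, mem_sdiff] at ha ha'
    exact ha'.1.2 ha.1.2
  have e2 : U ∩ B = (U ∩ D ∩ B) ∪ ((U \ D) ∩ B) := by
    ext a; simp only [mem_inter, mem_union, mem_sdiff]; tauto
  have d2 : Disjoint (U ∩ D ∩ B) ((U \ D) ∩ B) := by
    rw [disjoint_left]; intro a ha ha'
    simp only [mem_inter, mem_sdiff] at ha ha'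
    exact ha'.1.2 ha.1.2
  rw [e1, card_union_of_disjoint d1, e2, card_union_of_disjoint d2]
  omega

/-! ### The lattice form of the conjecture -/

/-- **The five-up-set inequality on a finite distributive lattice** (CONJECTURE (♠_L), report §12.1; an obligation of our theories, never
a fact): for every finite distributive lattice `L`, every order-reversing bijection `τ` of `L`, and up-sets `P, A₀ ⊆ A₁, B₀ ⊆ B₁`,
`#(P ∩ A₁ ∩ τB₀) + #(P ∩ τA₀ ∩ B₁) + #(P ∩ τ(A₁ \ A₀) ∩ τ(B₁ \ B₀)) ≤ #(P ∩ A₁ ∩ B₁) + #(P ∩ A₀ ∩ B₀)`.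
Census (report §12.1): products of chains with coordinate reversal incl. `[4]×[3]` exhaustive (8,403,500 quintuples), `J(Q)` for self-dual `Q`,
`2^3` with twisted and non-involutive antipodes: 0 violations; it FAILS on non-lattices (two τ-swapped chains). [this work] -/
@[conjecture] def FiveUpSetIneqLattice : Prop :=
  ∀ (L : Type) [DistribLattice L] [Fintype L] [DecidableEq L] (τ : L ≃ L), (∀ a b : L, τ a ≤ τ b ↔ b ≤ a) →
    ∀ (P A₀ A₁ B₀ B₁ : Finset L),
    IsUpperSet (P : Set L) → IsUpperSet (A₀ : Set L) → IsUpperSet (A₁ : Set L) →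
    IsUpperSet (B₀ : Set L) → IsUpperSet (B₁ : Set L) → A₀ ⊆ A₁ → B₀ ⊆ B₁ →
      (P ∩ A₁ ∩ B₀.image τ).card + (P ∩ A₀.image τ ∩ B₁).card + (P ∩ (A₁ \ A₀).image τ ∩ (B₁ \ B₀).image τ).card
        ≤ (P ∩ A₁ ∩ B₁).card + (P ∩ A₀ ∩ B₀).card

/-- On the cube `Finset α` the complement is an order-reversing bijection and `FiveUpSet.refl 𝒜 = 𝒜.image compl`; hence the lattice
conjecture specialises to the gen-6 conjecture: `FiveUpSetIneqLattice → FiveUpSetIneq`. [this work] -/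
theorem fiveUpSetIneq_of_lattice (h : FiveUpSetIneqLattice) : FiveUpSet.FiveUpSetIneq := by
  intro α _ _ P A₀ A₁ B₀ B₁ hP hA₀ hA₁ hB₀ hB₁ hA hB
  let τ : Finset α ≃ Finset α := ⟨compl, compl, compl_compl, compl_compl⟩
  have hτ : ∀ a b : Finset α, τ a ≤ τ b ↔ b ≤ a := fun a b => Finset.compl_subset_compl
  have key := h (Finset α) τ hτ P A₀ A₁ B₀ B₁ hP hA₀ hA₁ hB₀ hB₁ hA hB
  have er : ∀ 𝒜 : Finset (Finset α), FiveUpSet.refl 𝒜 = 𝒜.image τ := by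
    intro 𝒜
    ext s
    rw [FiveUpSet.mem_refl, mem_image]
    constructor
    · intro hs; exact ⟨sᶜ, hs, compl_compl s⟩
    · rintro ⟨t, ht, rfl⟩; simpa [τ] using ht
  simp only [er]
  exact key

end LatticeFiveUpSet

end Summit.CriticalPhenomena.PercolationContinuityZ3.Theorems
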